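import Summits.QuantumFields.BalabanUV.T4Continuum.Spine.NE1p.DressedTerminalWitnessReuse

/-!
# T⁴ programme, spine estimate NE1′ (node O3b/H2) — THE BLOCK GEOMETRY ACTS, part 1 of 2: a decided function-level toy with `Lb⁴`
# FAMILIES, ONE PER BLOCK OF `[0, Lb)⁴ ⊂ ℕ⁴`, coarsened by the anchoring into ONE met component one scale up — booking, tower,
# anchoring with NON-TRIVIAL coarsening, housing, the live `Lb⁴`-term cross-family dictionary, the booking convention
# (swarm witness «W14» of `t4/formal/NE1p/LEAVES.md`, INTENT CLAIMS.log l.11641) [decided toy]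

Cell `pub-balaban`, sub-cell `t4`, BINDER-OWNERS row NE1′ (owner lineage t4-ne1p-p1); formalisation crew
`b2b-balaban-t4-ne1p-formalise-*`, seat `…-leaf-09` (gen 4; lineage rows S3 ∕ S3-sup ∕ S3b ∕ S3d ∕ S3g ∕ S3h ∕ W5c ∕ S3k ∕ S3l).
ADDITIVE — imports leaf-02-g4's row W11r part 1 `Spine/NE1p/DressedTerminalWitnessReuse` (p216180: the integer-window arithmetic
`natL_pos` ∕ `one_le_natL` ∕ `natL_le_LW` ∕ `psi_le_psiL` ∕ `tau_pow_le` ∕ `hloc_int` ∕ `hsmall_int` ∕ `hfan_int` ∕ `hamp_int` ∕ `hvN₀_int`,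
the cut exponent `𝒬T` with `hFnT`, the booking-convention lemmas `osc_le` ∕ `osc_dirW` ∕ `hneM` — all reused BY NAME, nothing
duplicated (typer R-T61 (ii)(a)); through it this lineage's S3l `DressedStabilityOfCanonicalSliceWinSchedules` p215128 (the canonical
terminal face; `T4FeltGeometry.Anchoring` ∕ `coarsen`), leaf-03's W7 part 2 `DressedTowerWitnessSliceEnd` p214558 (the one-family datum
`BM` ∕ `TM` ∕ `aM` ∕ `cM` ∕ `FnM` ∕ `𝒬M` ∕ `shiftM` ∕ `Wm` ∕ `atomW` ∕ `defW` ∕ `dfW` ∕ `dirW`, `FnM_succ`, `hslM`, `relGauge_pairs`,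
`zero_mem_windowM`; W5's `flAt` calculus, `zeroExp`, `LW`) and leaf-07-g2's S3c `DressedCellNecessity` p213339) ONLY; modifies nothing.
Part 2 = `Spine/NE1p/DressedTowerWitnessBlocksEnd.lean` (the terminal face APPLIED at every integer of the window).

WHY.  Every function-level or booking-level toy of the crew (W5 ∕ W7 ∕ W7c ∕ W8 ∕ W9 ∕ W10 ∕ W12, and W11 ∕ W13 as announced) anchors
its families at the ZERO BLOCK ONLY (`dom ≡ {0}`, `center ≡ 0`): the anchoring's `coarsen` never acts, `T4FeltGeometry.card_feltSet_le`'s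
box fibres are exercised with at most one felt family per cube one scale up, and (w3-book) L-C's positional count `N₀·Λ^{k−j}`,
`Λ = L⁴` — THE constant END-B's strict product `Λ·ρ₁·τ ≤ ρ′ < 1` is built for — is never approached.  This toy makes the block
geometry ACT: `Lb⁴` families, family `f : Fin 4 → Fin Lb` born at scale `0` and localised at the block `↑f ∈ [0, Lb)⁴`; at scale
`0` each block is its own cube (feeling its own family), at every scale `k ≥ 1` ONE cube centred at the block `0` feels ALL families
— `felt_under` by the genuine coarsening `⌊f_i ∕ Lb^k⌋ = 0` (`coarsen_coords_succ`); per-block multiplicity `mB = 1` by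
injectivity of the block coordinates (`hmultP`); met components = that one cube (`v = 1`), live families `S k b = univ` for
`1 ≤ k ≤ K` — so the count the terminal face DERIVES from the anchoring (`count_of_anchoring_cell`, rows S4 ∕ S3i) reads
`Lb⁴ ≤ 1·(Lb⁴)^{k}` and is ATTAINED at `k = 1` (`liveFamilies_card`; part 2 `count_attained`).  The function-level content is W7's
BY NAME for every family (affine carried functional `FnM`, two-atom laws, ONE cutoff-free schedule `Wm`): the H2 dictionary is the
LIVE `Lb⁴`-TERM cross-family sum `c_k·Σ_{(f,0) ∈ Sg k b} (FnM K 0 k (U+z) − FnM K 0 k (U+0))` with source factor `c_k = (4Lb⁴)⁻¹`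
(`¼` at `k = 0`, where the component is the family alone), which EQUALS W7's `𝒬M K k = ¼·a_K·z₀₀` (`hQP`, by `Finset.sum_const` and
`#(Fin 4 → Fin Lb) = Lb⁴`) — so W7's weighted two-point step law `FnM_succ` serves every family VERBATIM (W11r's `hFnT` BY NAME).
* §1 blocks, coordinates, coarsening; §2 booking `BP K Lb`, trajectory `TP K Lb`, tower `towerP Lb`; §3 anchoring `anchP`, met
  components `compP`, live families `SP` ∕ generations `SgP` ∕ source factor `cP` (cut above the cutoff — no cube lives there; the
  exponent is W11r's cut `𝒬T`), `hscaleP` ∕ `hvolP` ∕ `hhousedP` ∕ `hSgP` ∕ `liveFamilies_card`; §4 the dictionary `hQP` (the step law is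
  W11r's `hFnT` BY NAME); §5 births `hslP`, the booking convention for every family (`lin_eq_increment`, `hsupP` by `le_csSup` over
  W11r's `osc_le` ∕ `osc_dirW` — the realised-increment set BOUNDED and ATTAINED), the history-free absorption door `habsP` (EQUALITY),
  no regeneration `hregP`.

HONEST FRAMING.  A decided toy ([folklore]; 0 sorry; 0 citations; no `def … : Prop` — the `def`s are toy ∕ instantiation DATA);
NOTHING of Bałaban's localisation domains, large-field components, D-terms or windows is modelled or asserted.  DECLARED ≡ 0: action
exponent `𝒜 ≡ 0`, action margins `s ≡ 0`, regeneration `creg ≡ 0`, absorbed sets `Sabs ≡ ∅`, `rel = Eq` (their live corners are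
W9 ∕ W12, W10, W13).  Headline (c4): «the block geometry of (w3-book) L-C ACTS on a decided toy — coarsening non-trivial, the derived
positional count attained, an `Lb⁴`-term live dictionary — and (part 2) the canonical terminal face fires on it at every integer
`81 ≤ Lb ≤ 120`; non-vacuity of SHAPES only — NE1′ ⇐ the named binders, NOT proved, NOT printed; 0 binders instantiated on Bałaban's
densities»; spine PROVED 0∕9.  Rung (B)+1 on ONE finite four-torus — NOT infinite volume, NOT a mass gap, NOT OS on ℝ⁴, NOT Clay,
NOT summit progress.  HONEST DEPENDENCY: continuum YM on T⁴ ⇐ BetaPertH ∧ nine spine estimates (0/9 proved); BetaPertH ⇐ (D1) ∧ (D4) ∧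
CAP+tail; G-an2-4 gates asym, D1 and NE2/3/4.
-/

noncomputable section

namespace Summit.QuantumFields.BalabanUV.T4Continuum.NE1p.DressedTowerWitnessBlocks

open MeasureTheory Set Metric Filter Finset
open scoped BigOperators
open Literature.MathematicalPhysics.QuantumFieldTheory.Balaban1983to89
open Literature.MathematicalPhysics.QuantumFieldTheory.Balaban1983to89.T4TermFormat
open Literature.MathematicalPhysics.QuantumFieldTheory.Balaban1983to89.T4TermFormat.Booking
open Literature.MathematicalPhysics.QuantumFieldTheory.Balaban1983to89.T4FeltGeometry
open Literature.MathematicalPhysics.QuantumFieldTheory.Balaban1983to89.T4GatedBooking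
open Literature.MathematicalPhysics.QuantumFieldTheory.Balaban1983to89.T4TrajectoryComparison
open T4TrajectoryModulus (bondBall bondBall_add_mem bondBall_latMove_add_mem bondBall_diam)
open T4BlockTransport (Fld NDir latMove latN Site norm_dir_le)
open T4BirthChartTransport (GaugeInvariant BirthSlice RelGauge)
open T4TrajectoryDensity
open Summit.QuantumFields.BalabanUV.T4Continuum.T4TrajectoryDensityDressed
open Summit.QuantumFields.BalabanUV.T4Continuum.T4TrajectoryDensityWitness
open Summit.QuantumFields.BalabanUV.T4Continuum.NE1p.DressedRoot
open Summit.QuantumFields.BalabanUV.T4Continuum.NE1p.DressedUniformConstants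
open Summit.QuantumFields.BalabanUV.T4Continuum.NE1p.DressedWindowScheduleWin
open Summit.QuantumFields.BalabanUV.T4Continuum.NE1p.DressedWindowScheduleModWin
open Summit.QuantumFields.BalabanUV.T4Continuum.NE1p.DressedTowerWitness
open Summit.QuantumFields.BalabanUV.T4Continuum.NE1p.DressedTowerWitnessSlice
open Summit.QuantumFields.BalabanUV.T4Continuum.NE1p.DressedTerminalWitnessReuse

/-! ## §1 Blocks of `[0, Lb)⁴`, their coordinates in `ℕ⁴`, and the coarsening [folklore] -/

/-- The blocks of the scale-`0` layer: `[0, Lb)⁴ ⊂ ℕ⁴`, one family per block. [folklore] -/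
abbrev Blk (Lb : ℕ) : Type := Fin 4 → Fin Lb

/-- Block coordinates in `ℕ⁴`. [folklore] -/
def coords {Lb : ℕ} (x : Blk Lb) : Fin 4 → ℕ := fun i => (x i : ℕ)

/-- Block coordinates are injective. [folklore] -/
theorem coords_injective {Lb : ℕ} : Function.Injective (coords (Lb := Lb)) := fun _ _ h =>
  funext fun i => Fin.ext (congrFun h i)

/-- No coarsening at the birth scale: `coarsen Lb 0 = id`. [folklore] -/
theorem coarsen_coords_zero {Lb : ℕ} (x : Blk Lb) : coarsen Lb 0 (coords x) = coords x := by
  funext i; simp [coarsen]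

/-- **THE COARSENING ACTS** [folklore]: one or more `Lb`-fold blockings send every block of `[0, Lb)⁴` to the block `0`
(`⌊x_i ∕ Lb^{n+1}⌋ = 0` since `x_i < Lb ≤ Lb^{n+1}`). -/
theorem coarsen_coords_succ {Lb : ℕ} (x : Blk Lb) (n : ℕ) : coarsen Lb (n + 1) (coords x) = 0 := by
  funext i
  simp only [coarsen, coords, Pi.zero_apply]
  exact Nat.div_eq_of_lt ((x i).isLt.trans_le (Nat.le_self_pow (Nat.succ_ne_zero n) Lb))

/-! ## §2 The datum: `Lb⁴` families born at scale `0`, W7's sizes per family, cubes = blocks at scale `0` and ONE cube above [decided toy] -/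

/-- TOY BOOKING at cutoff `K` with `Lb⁴` families [decided toy]: family `f : Fin 4 → Fin Lb` born at scale `0`, localised at its block;
cubes: at scale `0` one per block (feeling its own family), at each scale `1 … K` ONE cube (feeling every family); every family has
W7's POSITIVE size `a_K·ψ_W^{k+1}∕2` at scale `k`.  Nothing of Bałaban's is modelled. [folklore] -/
def BP (K Lb : ℕ) : T4TermFormat.Booking where
  K := K
  Dom := Blk Lb
  domScale := fun _ => 0
  treeLen := fun _ => 0
  treeLen_nonneg := fun _ => le_rfl
  balSize := fun _ => 0
  Birth := Blk Lb
  births := Finset.univ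
  mem_births := fun b => Finset.mem_univ b
  birthScale := fun _ => 0
  birth_le := fun _ => Nat.zero_le K
  loc := id
  loc_scale := fun _ => rfl
  Cube := Blk Lb ⊕ Fin K
  cubes := Finset.univ
  mem_cubes := fun q => Finset.mem_univ q
  cubeScale := fun q => Sum.elim (fun _ => 0) (fun j => j.val + 1) q
  cube_le := by
    rintro (x | j)
    · exact Nat.zero_le K
    · exact j.isLt
  feltAt := fun q => Sum.elim (fun x => {x}) (fun _ => Finset.univ) q
  felt_birth_le := fun _ _ _ => Nat.zero_le _
  size := fun _ k => aM K * defW (k + 1)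
  size_nonneg := fun _ k => (mul_pos (aM_pos K) (defW_pos (k + 1))).le
  pair := fun _ _ _ => 0

/-- TOY TRAJECTORY [decided toy]: per family W7's one generation (the birth, size `a_K·(c_M + 3)`) and `lin f 0 k = a_K·ψ_W^{k+1}∕2`.
[folklore] -/
def TP (K Lb : ℕ) : Trajectory (BP K Lb) where
  lin := fun _ k' k => if k' = 0 then aM K * defW (k + 1) else 0
  lin_nonneg := fun _ k' k => by
    split_ifs
    · exact (mul_pos (aM_pos K) (defW_pos (k + 1))).le
    · exact le_rfl
  gen := fun _ k' => if k' = 0 then aM K * (cM + 3) else 0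
  gen_nonneg := fun _ k' => by
    split_ifs
    · exact (mul_pos (aM_pos K) (by linarith [cM_pos])).le
    · exact le_rfl
  size_le := fun b k _ _ => by
    show aM K * defW (k + 1) ≤ ∑ k' ∈ Icc 0 k, (if k' = 0 then aM K * defW (k + 1) else 0)
    rw [Finset.sum_ite_eq' (Icc 0 k) 0 (fun _ => aM K * defW (k + 1))]
    simp

/-- TOY TOWER with `Lb⁴` families [decided toy]: the datum at every cutoff (one run parameter). [folklore] -/
def towerP (Lb : ℕ) : DressedTower Unit where
  B := fun _ K => BP K Lb
  K_eq := fun _ _ => rfl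
  T := fun _ K => TP K Lb

/-- The toy is non-degenerate: every booked size of every family is positive at every cutoff and scale. [folklore] -/
theorem towerP_size_pos (K Lb k : ℕ) (f : (BP K Lb).Birth) : 0 < (BP K Lb).size f k := mul_pos (aM_pos K) (defW_pos (k + 1))

/-! ## §3 The anchoring with non-trivial coarsening, met components, live families cut at the cutoff, the dictionary's data [decided toy] -/

/-- **THE ANCHORING ON `ℕ⁴` WITH BLOCKING INTEGER `Lb` — COARSENING ACTING** [decided toy]: family `f` is localised at the block
`↑f ∈ [0, Lb)⁴` of scale `0`; the scale-`0` cube of block `x` is centred at `↑x`, every higher cube at the block `0`; `felt_under`: at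
scale `0` by `coarsen Lb 0 = id` (a block feels its own family), at scale `k ≥ 1` by `coarsen Lb k ↑f = 0` (ALL `Lb⁴` families coarsen
into the one cube).  Genuine anchoring data; nothing of Bałaban's localisation domains. [folklore] -/
def anchP (K Lb : ℕ) : Anchoring (BP K Lb) 4 Lb where
  dom := fun f => {coords f}
  center := fun q => Sum.elim (fun x => coords x) (fun _ => 0) q
  felt_under := by
    rintro (x | j) f hf
    · have hfx : f = x := Finset.mem_singleton.mp hf
      subst hfx
      exact ⟨coords f, Finset.mem_singleton_self _, coarsen_coords_zero f⟩
    · exact ⟨coords f, Finset.mem_singleton_self _, coarsen_coords_succ f j.val⟩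

/-- **PER-BLOCK MULTIPLICITY `mB = 1`** [decided toy]: a block lies in the domain of at most one family — by injectivity of the
block coordinates (not because there is one family). [folklore] -/
theorem hmultP (K Lb : ℕ) : ∀ j (x : Fin 4 → ℕ),
    ((BP K Lb).births.filter fun b => (BP K Lb).birthScale b = j ∧ x ∈ (anchP K Lb).dom b).card ≤ 1 := by
  intro j x
  refine Finset.card_le_one.mpr fun a ha b hb => ?_
  have ha' : x ∈ ({coords a} : Finset (Fin 4 → ℕ)) := (Finset.mem_filter.mp ha).2.2
  have hb' : x ∈ ({coords b} : Finset (Fin 4 → ℕ)) := (Finset.mem_filter.mp hb).2.2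
  rw [Finset.mem_singleton] at ha' hb'
  exact coords_injective (ha'.symm.trans hb')

/-- MET COMPONENTS [decided toy]: at scale `0` the family's own block cube; at scales `1 … K` the ONE cube of the scale (all families
met); none above the cutoff.  Volume `v = 1`. [folklore] -/
def compP (K Lb k : ℕ) (b : Blk Lb) : Finset (Blk Lb ⊕ Fin K) :=
  if h0 : k = 0 then {Sum.inl b} else if h : k ≤ K then {Sum.inr ⟨k - 1, by omega⟩} else ∅

/-- LIVE FAMILIES of the met component of `b` at step `k` [decided toy]: the family alone at scale `0`, ALL `Lb⁴` families at scales
`1 … K`, none above the cutoff. [folklore] -/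
def SP (K Lb k : ℕ) (b : Blk Lb) : Finset (Blk Lb) :=
  if k = 0 then {b} else if k ≤ K then Finset.univ else ∅

/-- LIVE GENERATIONS of the met component [decided toy]: every live family's (only) generation `0`. [folklore] -/
def SgP (K Lb k : ℕ) (b : Blk Lb) : Finset (Blk Lb × ℕ) :=
  if k = 0 then {(b, 0)} else if k ≤ K then Finset.univ ×ˢ {0} else ∅

/-- THE SOURCE FACTOR of the met component at step `k` [decided toy]: `¼` at scale `0` (one family), `(4·Lb⁴)⁻¹` at scales `≥ 1`
(`Lb⁴` families) — so that the dictionary's sum IS W7's exponent (`hQP`). [folklore] -/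
def cP (Lb k : ℕ) : ℂ := if k = 0 then ((1 / 4 : ℝ) : ℂ) else ((1 / (4 * (Lb : ℝ) ^ 4) : ℝ) : ℂ)

/-- [folklore] The component's cubes have the current scale. -/
theorem hscaleP (K Lb : ℕ) : ∀ k b, ∀ q ∈ compP K Lb k b, (BP K Lb).cubeScale q = k := by
  intro k b q hq
  unfold compP at hq
  split_ifs at hq with h0 h
  · rw [Finset.mem_singleton] at hq; subst hq; exact h0.symm
  · rw [Finset.mem_singleton] at hq; subst hq
    show k - 1 + 1 = k
    omega
  · simp at hq

/-- [folklore] Component volume `v = 1`. -/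
theorem hvolP (K Lb : ℕ) : ∀ k b, (compP K Lb k b).card ≤ 1 := by
  intro k b; unfold compP; split_ifs <;> simp

/-- **LIVE FAMILIES ARE HOUSED** [decided toy]: at scale `0` the family in its own block cube; at scales `1 … K` ALL `Lb⁴` families in
the ONE cube of the scale (which feels them all, by the coarsening). [folklore] -/
theorem hhousedP (K Lb : ℕ) : ∀ k b, ∀ f ∈ SP K Lb k b, ∃ q ∈ compP K Lb k b, f ∈ (BP K Lb).feltAt q := by
  intro k b f hf
  unfold SP at hf
  unfold compP
  split_ifs at hf ⊢ with h0 h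
  · rw [Finset.mem_singleton] at hf
    subst hf
    exact ⟨Sum.inl f, Finset.mem_singleton_self _, Finset.mem_singleton_self _⟩
  · exact ⟨Sum.inr ⟨k - 1, by omega⟩, Finset.mem_singleton_self _, Finset.mem_univ f⟩
  · simp at hf

/-- [folklore] Membership in the live generations: a live family's generation `0`. -/
theorem mem_SgP {K Lb k : ℕ} {b : Blk Lb} {x : Blk Lb × ℕ} (hx : x ∈ SgP K Lb k b) : x.1 ∈ SP K Lb k b ∧ x.2 = 0 := by
  unfold SgP at hx
  unfold SP
  split_ifs at hx ⊢ with h0 h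
  · rw [Finset.mem_singleton] at hx; subst hx
    exact ⟨Finset.mem_singleton_self _, rfl⟩
  · rw [Finset.mem_product, Finset.mem_singleton] at hx
    exact ⟨Finset.mem_univ _, hx.2⟩
  · simp at hx

/-- `hSg` [decided toy]: a live generation is a live family's, born (scale `0`), not from the future. [folklore] -/
theorem hSgP (K Lb : ℕ) : ∀ (k : ℕ) (b : Blk Lb), ∀ p ∈ SgP K Lb k b,
    p.1 ∈ SP K Lb k b ∧ (BP K Lb).birthScale p.1 ≤ p.2 ∧ p.2 ≤ k := by
  intro k b p hp
  obtain ⟨h1, h2⟩ := mem_SgP hp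
  exact ⟨h1, Nat.zero_le _, h2 ▸ Nat.zero_le _⟩

/-- **THE MET COMPONENT CARRIES `Lb⁴` LIVE FAMILIES** at every scale `1 ≤ k ≤ K` [decided toy] — all born at scale `0`, so the
positional count the terminal face derives from the anchoring (`N₀·(Lb⁴)^{k−0}`, `N₀ = 1`) is ATTAINED at `k = 1`. [folklore] -/
theorem liveFamilies_card {K Lb k : ℕ} (h1 : 1 ≤ k) (hk : k ≤ K) (b : Blk Lb) : (SP K Lb k b).card = Lb ^ 4 := by
  unfold SP
  rw [if_neg (by omega), if_pos hk, Finset.card_univ]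
  simp

/-- [folklore] At scale `0` the live generation is the family's own. -/
theorem SgP_zero (K Lb : ℕ) (b : Blk Lb) : SgP K Lb 0 b = {(b, 0)} := if_pos rfl

/-- [folklore] At scales `1 … K` the live generations are ALL families' generation `0`. -/
theorem SgP_mid {K Lb k : ℕ} (h0 : k ≠ 0) (hk : k ≤ K) (b : Blk Lb) : SgP K Lb k b = Finset.univ ×ˢ {0} := by
  unfold SgP; rw [if_neg h0, if_pos hk]

/-- [folklore] Above the cutoff there is no live generation. -/
theorem SgP_top {K Lb k : ℕ} (h0 : k ≠ 0) (hk : ¬ k ≤ K) (b : Blk Lb) : SgP K Lb k b = ∅ := by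
  unfold SgP; rw [if_neg h0, if_neg hk]

/-- [folklore] The source factor at scale `0`. -/
theorem cP_zero (Lb : ℕ) : cP Lb 0 = ((1 / 4 : ℝ) : ℂ) := if_pos rfl

/-- [folklore] The source factor at scales `≥ 1`. -/
theorem cP_of_ne_zero {Lb k : ℕ} (h0 : k ≠ 0) : cP Lb k = ((1 / (4 * (Lb : ℝ) ^ 4) : ℝ) : ℂ) := if_neg h0

/-! ## §4 The H2 dictionary as an `Lb⁴`-term cross-family sum (the step law is W11r's `hFnT`) [decided toy] -/

/-- **THE DICTIONARY `hQ` AS AN EQUATION — AN `Lb⁴`-TERM LIVE CROSS-FAMILY SUM** [decided toy]: at scales `1 … K` the centred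
observable-attached exponent of the met component is `(4Lb⁴)⁻¹·Σ_{(f,0)} (FnM K 0 k (U+z) − FnM K 0 k (U+0))` over ALL `Lb⁴` live
families, each contributing `a_K·z₀₀` — which IS W7's `𝒬M K k U z = ¼·a_K·z₀₀` (`#(Fin 4 → Fin Lb) = Lb⁴`, `Lb ≠ 0`), i.e.
W11r's cut exponent `𝒬T K k`; at scale `0` the one-family sum with `¼`; above the cutoff both sides vanish. [folklore] -/
theorem hQP (K : ℕ) {Lb : ℕ} (hLb : 0 < Lb) (b : Blk Lb) (k : ℕ) :
    (fun U z => 𝒬T K k U z - (fun (_ : Fld 4 ℂ) => (0 : ℂ)) U) =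
      fun U z => cP Lb k * ∑ p ∈ SgP K Lb k b,
        (FnM K p.2 k (U + z) - FnM K p.2 k (U + (fun (_ : Blk Lb) (_ : ℕ) => (0 : Fld 4 ℂ)) b k)) := by
  have hLbC : (Lb : ℂ) ≠ 0 := by exact_mod_cast hLb.ne'
  by_cases h0 : k = 0
  · subst h0
    rw [𝒬T_of_le (Nat.zero_le K), cP_zero, SgP_zero]
    funext U z
    simp only [Finset.sum_singleton, FnM, ↓reduceIte, ev₀₀_add, add_zero, 𝒬M, sub_zero]
    ring
  · by_cases hk : k ≤ K
    · rw [𝒬T_of_le hk, cP_of_ne_zero h0, SgP_mid h0 hk]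
      funext U z
      simp only [Finset.sum_product, Finset.sum_singleton, FnM, ↓reduceIte, ev₀₀_add, add_zero, 𝒬M, sub_zero, Finset.sum_const,
        Finset.card_univ, Fintype.card_pi, Fintype.card_fin, Finset.prod_const, nsmul_eq_mul]
      push_cast
      field_simp
      ring
    · rw [𝒬T_of_not_le hk, cP_of_ne_zero h0, SgP_top h0 hk]
      funext U z
      simp [zeroExp]

/-- `hcm` [decided toy]: the source factor is below `m = ¼` at every scale (`¼` at scale `0`, `(4Lb⁴)⁻¹ ≤ ¼` above, `Lb ≥ 1`). [folklore] -/
theorem hcmP {Lb : ℕ} (hLb : 1 ≤ Lb) (k : ℕ) : ‖cP Lb k‖ ≤ 1 / 4 := by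
  unfold cP
  have hL : (1 : ℝ) ≤ (Lb : ℝ) := by exact_mod_cast hLb
  have hL4 : (1 : ℝ) ≤ (Lb : ℝ) ^ 4 := one_le_pow₀ hL
  split_ifs
  · rw [Complex.norm_real, Real.norm_eq_abs, abs_of_pos (by norm_num)]
  · rw [Complex.norm_real, Real.norm_eq_abs, abs_of_pos (by positivity)]
    exact one_div_le_one_div_of_le (by norm_num) (by nlinarith)

/-! ## §5 Births, the booking convention, the absorption door, regeneration — for every family, W7's content [decided toy] -/

/-- `hsl` (w1) for every family [decided toy]: W7's birth slice (the generation sizes of `TP` ARE W7's). [folklore] -/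
theorem hslP (K Lb : ℕ) (f : (BP K Lb).Birth) (k' : ℕ) :
    BirthSlice (FnM K k' k') latMove latN (bondBall 4 (Wm.ρw k') : Set (Fld 4 ℂ)) 1 1 ((TP K Lb).gen f k') :=
  hslM K () k'

/-- **THE BOOKED SIZE IS A REALISED INCREMENT** [decided toy]: for every family, `lin f k′ k` is EXACTLY the increment of the carried
functional along W7's pair `(0, latMove 0 (dirW (k+1)) 1)` — W11r's `osc_dirW` (the sizes of `TP` ARE W7's). [folklore] -/
theorem lin_eq_increment (K Lb : ℕ) (f : (BP K Lb).Birth) (k' k : ℕ) :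
    (TP K Lb).lin f k' k = ‖FnM K k' k (latMove 0 (dirW (k + 1)) 1) - FnM K k' k 0‖ :=
  (osc_dirW K () k' k).symm

/-- **`hsup` — THE BOOKED SIZE IS BELOW THE SUP OF THE REALISED INCREMENTS, FOR EVERY FAMILY** [decided toy]: `le_csSup` — the
realised-increment set is bounded above (W11r's `osc_le`) and contains the booked size (`lin_eq_increment`); the booking convention of
row S8 MET for each of the `Lb⁴` families at every step of every cutoff; the `Real.sSup` is not junk.  (`hne` is W11r's `hneM`.) [folklore] -/
theorem hsupP (K Lb : ℕ) (f : (BP K Lb).Birth) (k' k : ℕ) :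
    (TP K Lb).lin f k' k ≤ sSup {x : ℝ | ∃ U₀ ∈ (bondBall 4 (Wm.ρw k) : Set (Fld 4 ℂ)), ∃ U₁ : Fld 4 ℂ,
      RelGauge (fun U U' : Fld 4 ℂ => U = U') latMove latN U₀ U₁ (defW (k + 1)) ∧
        x = ‖FnM K k' k U₁ - FnM K k' k U₀‖} := by
  refine le_csSup ⟨(TM K).lin () k' k, ?_⟩ ?_
  · rintro x ⟨U₀, -, U₁, hrel, rfl⟩
    exact osc_le K () k' k hrel
  · exact ⟨0, zero_mem_windowM k, latMove 0 (dirW (k + 1)) 1, ⟨dirW (k + 1), defW_pos (k + 1), le_rfl, rfl⟩,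
      lin_eq_increment K Lb f k' k⟩

/-- THE HISTORY-FREE ABSORPTION DOOR, WITH EQUALITY [decided toy]: `Sabs ≡ ∅`, `A = 0`, dressing `β K j := (LW⁻³)^K`; the birth
identity `2·gen f 0 = 2·a_K·(c_M + 3) = (LW⁻³)^K` for every family, ANY rate, ANY gate. [folklore] -/
theorem habsP (K Lb : ℕ) (ρ : ℕ → ℝ) (Gate : ℕ → Prop) :
    (TP K Lb).AbsorbsFrom (4 * (1 / 2) / 1) ρ (fun _ : ℕ => (LW⁻¹ ^ 3) ^ K) 0 (fun _ => ∅) Gate := by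
  intro b _ _
  simp only [Finset.sum_empty, mul_zero, add_zero]
  show 4 * (1 / 2) / 1 * (if (0 : ℕ) = 0 then aM K * (cM + 3) else 0) ≤ (LW⁻¹ ^ 3) ^ K
  have hc : 0 < cM + 3 := by linarith [cM_pos]
  rw [if_pos rfl]
  unfold aM
  rw [show 4 * (1 / 2 : ℝ) / 1 * ((LW⁻¹ ^ 3) ^ K / (2 * (cM + 3)) * (cM + 3)) = (LW⁻¹ ^ 3) ^ K by field_simp; ring]

/-- (w5) `hreg` [decided toy]: no regeneration (later generations are `0`), for ANY gate. [folklore] -/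
theorem hregP (K Lb : ℕ) (Gate : ℕ → Prop) : (TP K Lb).RegeneratesFromVar (fun _ : ℕ => (0 : ℝ)) Gate :=
  fun b k _ _ _ => by
    show (if k + 1 = 0 then aM K * (cM + 3) else 0) ≤ 0 * ((BP K Lb).size b k)
    simp

end Summit.QuantumFields.BalabanUV.T4Continuum.NE1p.DressedTowerWitnessBlocks

end
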